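import Summits.HodgeConjecture.HodgeConjecture.Theorems.Ring2WeilCoverageCMFieldAllPrimesQ
import HarnessLib

/-!
# Weil-type components over quartic CM fields, IX (part R): the descent — peeling every odd prime off
# `Nm(z) = π·μ` in `ℤ[σ] = ℤ[√2]` (`σ = -3-√2`), down to a totally positive multiplier of 2-power norm

research route conditional on HC_CM; not a corollary; Q11.4-sentence-2 already refuted in dim ≥ 3. Cell
`pub-hodge-ring2`, seat `ring2-b03` (gen 53); `HOME/WEIL-FAMILY-COVERAGE.md` §b03.5, seventh table
(`E = ℚ(√-(3+√2)) = F(η)`, `η² = σ`, `F = ℚ(√2)`, `R = S² + 6S + 7`); coordinates as in parts P/Q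
(`z = (A,B,C,D)`, `Nm(z) = (X, Y)`, `π = (u,v)`, `μ = (M₀,M₁)`, products `(ac - 7bd, ad + bc - 6bd)`).

* §1 `exists_degOne_gen_dvd`: for an odd prime `q` with `2` a square mod `q` and `q ∣ N(μ)`, a totally positive
  degree-one generator `θ' = u' + v'σ` of norm `q` WITH Bezout data (`θ'γ' = t' + σ`) dividing `μ` — part H's
  Thue generator `x + y√2`, normalised to `x > 0`, replaced by its conjugate when `θ' ∣ μ̄` instead
  (part P `degOne_dvd_or_dvd_conj_of_dvd_norm`).
* §2 **`aux_descent`** (strong induction on the odd part `K` of `N(μ) = 2^e·K`): if `Nm(z) = π·μ` with `μ`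
  totally positive and every odd prime factor of `N(μ)` prime to `N(π)`, and if every SPLIT-type prime element
  of norm below the bound (`θ'` degree-one with `-t'` a square, `ℓ' < n`; or an inert rational `q` with `7` a
  square, `q² < n`) admits an integral witness `Nm(w) = θ'·μ_w` with `μ_w` totally positive of 2-power norm
  (hypotheses `HWdeg`, `HWinert` — supplied by the outer induction of part S), then `Nm(z') = π·μ'` for some
  integral `z'` and totally positive `μ'` with `N(μ') = 2^{e'}`. Each odd prime `q ∣ K` is removed by part Q:
  inert in `F` (`2` non-square): `q ∣ μ`, then `inert_peel` (`7` non-square, `K ↦ K/q⁴`) or `split_peel`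
  (`K ↦ K/q²`); split in `F`: a degree-one `θ' ∣ μ` (§1), then `inert_peel` (`-t'` non-square, `K ↦ K/q²`) or
  `split_peel` (`K ↦ K/q`).

No named fact, no definition, no `sorry`; nothing about the Hodge conjecture is asserted.
References: [Deligne1982HodgeCycles] §4 p. 30 (1), Cor. 4.2; [Landherr1936HermitianForms]. -/

noncomputable section

set_option linter.dupNamespace false

open Polynomial

namespace Summit.HodgeConjecture.HodgeConjecture.Ring2.WeilCoverageCM

/-! ### §1 A totally positive degree-one generator over `q` dividing `μ` -/

/-- **Thue generator with Bezout data.** For an odd prime `q` at which `2` is a square there are `u', v', g₀, g₁, t'`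
with `N(u',v') = q`, `θ'γ' = t' + σ` (`θ' = u' + v'σ`, `γ' = g₀ + g₁σ`) and `θ'` totally positive (part H's
`x² - 2y² = q` from Thue's lemma, `x > 0`; `θ' = x + y√2 = (x - 3y) - yσ`). [folklore] -/
theorem exists_degOne_gen {q : ℕ} (hq : q.Prime) (h2 : IsSquare (2 : ZMod q)) :
    ∃ u' v' g₀ g₁ t' : ℤ, u' ^ 2 - 6 * u' * v' + 7 * v' ^ 2 = q ∧ u' * g₀ - 7 * v' * g₁ = t' ∧
      v' * g₀ + u' * g₁ - 6 * v' * g₁ = 1 ∧ 0 < u' - 3 * v' := by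
  haveI : Fact q.Prime := ⟨hq⟩
  have hqp : Prime (q : ℤ) := Nat.prime_iff_prime_int.1 hq
  have hq0 : (q : ℤ) ≠ 0 := by exact_mod_cast hq.ne_zero
  obtain ⟨r, hr⟩ := h2
  obtain ⟨x₀, y₀, hxy₀, -⟩ := exists_sq_sub_two_mul_sq_eq_prime (ℓ := q) r (by rw [sq, ← hr])
  -- normalise `x > 0`
  obtain ⟨x, y, hxy, hx⟩ : ∃ x y : ℤ, x ^ 2 - 2 * y ^ 2 = q ∧ 0 < x := by
    rcases lt_trichotomy 0 x₀ with h | h | h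
    · exact ⟨x₀, y₀, hxy₀, h⟩
    · exfalso
      rw [← h] at hxy₀
      have : (0 : ℤ) < q := by exact_mod_cast hq.pos
      nlinarith [sq_nonneg y₀]
    · exact ⟨-x₀, -y₀, by linear_combination hxy₀, by linarith⟩
  -- `q ∤ y`, and `gcd(y, x) = 1`
  have hy : ¬ (q : ℤ) ∣ y := by
    rintro ⟨b, hb⟩
    have hxq : (q : ℤ) ∣ x ^ 2 := by
      refine ⟨1 + 2 * q * b ^ 2, ?_⟩
      rw [hb] at hxy
      linear_combination hxy
    obtain ⟨a, ha⟩ := hqp.dvd_of_dvd_pow hxq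
    have e : (q : ℤ) * (q * (a ^ 2 - 2 * b ^ 2) - 1) = 0 := by
      rw [ha, hb] at hxy
      linear_combination hxy
    have e' : (q : ℤ) * (a ^ 2 - 2 * b ^ 2) - 1 = 0 := (mul_eq_zero.1 e).resolve_left hq0
    have h1 : (q : ℤ) ∣ 1 := ⟨a ^ 2 - 2 * b ^ 2, by linear_combination -e'⟩
    exact hq.not_dvd_one (by exact_mod_cast h1)
  have hcop : IsCoprime y x := by
    rw [Int.isCoprime_iff_gcd_eq_one]
    obtain ⟨g, hg⟩ : ∃ g : ℤ, g = ((Int.gcd y x : ℕ) : ℤ) := ⟨_, rfl⟩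
    have hd1 : g ∣ y := by rw [hg]; exact Int.gcd_dvd_left y x
    have hd2 : g ∣ x := by rw [hg]; exact Int.gcd_dvd_right y x
    have hdl : g ∣ (q : ℤ) := by
      obtain ⟨c, hc⟩ := hd1
      obtain ⟨d, hd⟩ := hd2
      refine ⟨g * (d ^ 2 - 2 * c ^ 2), ?_⟩
      rw [← hxy, hc, hd]; ring
    rw [hg] at hdl hd1
    have hdl' : Int.gcd y x ∣ q := by exact_mod_cast hdl
    rcases (Nat.dvd_prime hq).1 hdl' with h | h
    · exact h
    · exfalso; rw [h] at hd1; exact hy hd1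
  have hcop' : IsCoprime (-y) (x + 3 * y) := by
    have h1 := (hcop.neg_left).add_mul_right_right (-3)
    have e : x + -3 * -y = x + 3 * y := by ring
    rwa [e] at h1
  obtain ⟨g₀, g₁, hbez⟩ := hcop'
  refine ⟨x - 3 * y, -y, g₀, g₁, (x - 3 * y) * g₀ - 7 * (-y) * g₁, by linear_combination hxy, rfl,
    by linear_combination hbez, by linarith⟩

/-- **A degree-one generator dividing `μ`.** For an odd prime `q` with `2` a square mod `q` and `q ∣ N(μ)`,
`μ = M₀ + M₁σ`: a totally positive `θ' = u' + v'σ` of norm `q` with Bezout data and `θ' ∣ μ` (explicit quotient)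
— the Thue generator or its conjugate `θ̄' = (u' - 6v') - v'σ` (data `6 - t'`, `(6g₁ - g₀) + g₁σ`), by Euclid
(`q = θ'θ̄' ∣ μμ̄`). [folklore] -/
theorem exists_degOne_gen_dvd {q : ℕ} (hq : q.Prime) (h2 : IsSquare (2 : ZMod q)) (M₀ M₁ : ℤ)
    (hdvd : (q : ℤ) ∣ M₀ ^ 2 - 6 * M₀ * M₁ + 7 * M₁ ^ 2) :
    ∃ u' v' g₀ g₁ t' c d : ℤ, u' ^ 2 - 6 * u' * v' + 7 * v' ^ 2 = q ∧ u' * g₀ - 7 * v' * g₁ = t' ∧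
      v' * g₀ + u' * g₁ - 6 * v' * g₁ = 1 ∧ 0 < u' - 3 * v' ∧
      M₀ = u' * c - 7 * v' * d ∧ M₁ = u' * d + v' * c - 6 * v' * d := by
  obtain ⟨u', v', g₀, g₁, t', hN, ht, hγ, hpos⟩ := exists_degOne_gen hq h2
  rcases degOne_dvd_or_dvd_conj_of_dvd_norm hN ht hγ hq M₀ M₁ hdvd with ⟨c, d, hc, hd⟩ | ⟨e, f, he, hf⟩
  · exact ⟨u', v', g₀, g₁, t', c, d, hN, ht, hγ, hpos, hc, hd⟩
  · -- `θ' ∣ μ̄`, i.e. `θ̄' ∣ μ` with quotient `(e - 6f, -f)`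
    refine ⟨u' - 6 * v', -v', 6 * g₁ - g₀, g₁, 6 - t', e - 6 * f, -f, by linear_combination hN,
      by rw [← ht]; linear_combination 6 * hγ, by linear_combination hγ, by linarith, ?_, ?_⟩
    · have hM₁ : M₁ = -(u' * f + v' * e - 6 * v' * f) := by linear_combination -hf
      have hM₀ : M₀ = u' * e - 7 * v' * f + 6 * M₁ := by linear_combination he
      rw [hM₀, hM₁]; ring
    · have hM₁ : M₁ = -(u' * f + v' * e - 6 * v' * f) := by linear_combination -hf
      rw [hM₁]; ring

/-! ### §2 The descent -/

/-- **The descent.** `π = u + vσ`; bound `n`. Hypotheses `HWdeg` / `HWinert`: every split-type prime element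
below the bound has an INTEGRAL norm witness with a totally positive multiplier of 2-power norm. Then for every
`K < n`: if `Nm(z) = π·μ`, `μ` totally positive, `N(μ) = 2^e·K`, and no odd prime divides both `N(μ)` and `N(π)`,
there are an integral `z'` and a totally positive `μ'` of 2-power norm with `Nm(z') = π·μ'`. [folklore] -/
theorem aux_descent (u v : ℤ) (n : ℕ)
    (HWdeg : ∀ (u' v' g₀ g₁ t' : ℤ) (ℓ' : ℕ), ℓ'.Prime → ℓ' ≠ 2 → ℓ' < n →
      u' ^ 2 - 6 * u' * v' + 7 * v' ^ 2 = ℓ' → u' * g₀ - 7 * v' * g₁ = t' → v' * g₀ + u' * g₁ - 6 * v' * g₁ = 1 →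
      0 < u' - 3 * v' → IsSquare (-(t' : ZMod ℓ')) →
      ∃ a₀ a₁ b₀ b₁ m₀ m₁ : ℤ, ∃ e : ℕ,
        a₀ ^ 2 - 7 * a₁ ^ 2 + 14 * b₀ * b₁ - 42 * b₁ ^ 2 = u' * m₀ - 7 * v' * m₁ ∧
        2 * a₀ * a₁ - 6 * a₁ ^ 2 - b₀ ^ 2 + 12 * b₀ * b₁ - 29 * b₁ ^ 2 = u' * m₁ + v' * m₀ - 6 * v' * m₁ ∧
        0 < m₀ - 3 * m₁ ∧ m₀ ^ 2 - 6 * m₀ * m₁ + 7 * m₁ ^ 2 = 2 ^ e)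
    (HWinert : ∀ q : ℕ, q.Prime → q ≠ 2 → q ^ 2 < n → ¬ IsSquare (2 : ZMod q) → IsSquare (7 : ZMod q) →
      ∃ a₀ a₁ b₀ b₁ m₀ m₁ : ℤ, ∃ e : ℕ,
        a₀ ^ 2 - 7 * a₁ ^ 2 + 14 * b₀ * b₁ - 42 * b₁ ^ 2 = (q : ℤ) * m₀ - 7 * 0 * m₁ ∧
        2 * a₀ * a₁ - 6 * a₁ ^ 2 - b₀ ^ 2 + 12 * b₀ * b₁ - 29 * b₁ ^ 2 = (q : ℤ) * m₁ + 0 * m₀ - 6 * 0 * m₁ ∧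
        0 < m₀ - 3 * m₁ ∧ m₀ ^ 2 - 6 * m₀ * m₁ + 7 * m₁ ^ 2 = 2 ^ e) :
    ∀ K : ℕ, K < n → ∀ (e : ℕ) (A B C D M₀ M₁ : ℤ),
      M₀ ^ 2 - 6 * M₀ * M₁ + 7 * M₁ ^ 2 = 2 ^ e * K → 0 < M₀ - 3 * M₁ →
      (∀ q : ℕ, q.Prime → q ≠ 2 → (q : ℤ) ∣ M₀ ^ 2 - 6 * M₀ * M₁ + 7 * M₁ ^ 2 →
        ¬ (q : ℤ) ∣ u ^ 2 - 6 * u * v + 7 * v ^ 2) →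
      A ^ 2 - 7 * B ^ 2 + 14 * C * D - 42 * D ^ 2 = u * M₀ - 7 * v * M₁ →
      2 * A * B - 6 * B ^ 2 - C ^ 2 + 12 * C * D - 29 * D ^ 2 = u * M₁ + v * M₀ - 6 * v * M₁ →
      ∃ (e' : ℕ) (A' B' C' D' M₀' M₁' : ℤ),
        A' ^ 2 - 7 * B' ^ 2 + 14 * C' * D' - 42 * D' ^ 2 = u * M₀' - 7 * v * M₁' ∧
        2 * A' * B' - 6 * B' ^ 2 - C' ^ 2 + 12 * C' * D' - 29 * D' ^ 2 = u * M₁' + v * M₀' - 6 * v * M₁' ∧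
        0 < M₀' - 3 * M₁' ∧ M₀' ^ 2 - 6 * M₀' * M₁' + 7 * M₁' ^ 2 = 2 ^ e' := by
  intro K
  induction K using Nat.strong_induction_on with
  | _ K ih =>
  intro hKn e A B C D M₀ M₁ hNμ hpos hcop hX hY
  have hNpos : 0 < M₀ ^ 2 - 6 * M₀ * M₁ + 7 * M₁ ^ 2 := by
    -- `N(μ) = 2^e K ≥ 0`; `N = 0` would give `(M₀ - 3M₁)² = 2M₁²`, impossible for `M₀ - 3M₁ ≠ 0`
    rcases (show 0 < M₀ ^ 2 - 6 * M₀ * M₁ + 7 * M₁ ^ 2 ∨ M₀ ^ 2 - 6 * M₀ * M₁ + 7 * M₁ ^ 2 = 0 by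
      rw [hNμ]; rcases Nat.eq_zero_or_pos K with h | h
      · right; rw [h]; simp
      · left; positivity) with h | h
    · exact h
    · exfalso
      have hsq : (M₀ - 3 * M₁) ^ 2 = 2 * M₁ ^ 2 := by linear_combination h
      rcases eq_or_ne M₁ 0 with h0 | h0
      · rw [h0] at hsq; have : M₀ - 3 * M₁ = 0 := by nlinarith
        rw [h0] at this; rw [h0] at hpos; linarith
      · have hq : ((M₀ - 3 * M₁ : ℤ) : ℚ) ^ 2 = 2 * ((M₁ : ℤ) : ℚ) ^ 2 := by exact_mod_cast hsq
        exact rat_sq_ne_prime_mul_sq Nat.prime_two (m := ((M₁ : ℤ) : ℚ)) (by exact_mod_cast h0) _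
          (by rw [hq]; norm_num)
  have hK0 : K ≠ 0 := by
    rintro rfl
    rw [Nat.cast_zero, mul_zero] at hNμ
    rw [hNμ] at hNpos
    exact lt_irrefl _ hNpos
  by_cases hK1 : K = 1
  · subst hK1
    exact ⟨e, A, B, C, D, M₀, M₁, hX, hY, hpos, by rw [hNμ, Nat.cast_one, mul_one]⟩
  -- an (odd or even) prime factor of `K`
  have hpK : (Nat.minFac K).Prime := Nat.minFac_prime hK1
  obtain ⟨K', hK'⟩ : Nat.minFac K ∣ K := Nat.minFac_dvd K
  set p := Nat.minFac K with hp
  have hp1 : 1 < p := hpK.one_lt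
  have hK'pos : 0 < K' := by
    rcases Nat.eq_zero_or_pos K' with h | h
    · rw [h, mul_zero] at hK'; exact absurd hK' hK0
    · exact h
  have hK'lt : K' < K := by
    calc K' = 1 * K' := (one_mul _).symm
      _ < p * K' := Nat.mul_lt_mul_of_pos_right hp1 hK'pos
      _ = K := hK'.symm
  by_cases hp2 : p = 2
  · -- shift a factor `2` into the exponent
    rw [hp2] at hK'
    refine ih K' hK'lt (lt_trans hK'lt hKn) (e + 1) A B C D M₀ M₁ ?_ hpos hcop hX hY
    rw [hNμ, hK']; push_cast; ring
  -- `p` is an odd prime dividing `N(μ)`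
  have hpdvdN : (p : ℤ) ∣ M₀ ^ 2 - 6 * M₀ * M₁ + 7 * M₁ ^ 2 := ⟨2 ^ e * K', by rw [hNμ, hK']; push_cast; ring⟩
  have hpπ : ¬ (p : ℤ) ∣ u ^ 2 - 6 * u * v + 7 * v ^ 2 := hcop p hpK hp2 hpdvdN
  have hpp : Prime (p : ℤ) := Nat.prime_iff_prime_int.1 hpK
  haveI : Fact p.Prime := ⟨hpK⟩
  -- coprimality of `p` to `2^e`
  have hcop2 : Nat.Coprime p 2 := (Nat.coprime_primes hpK Nat.prime_two).2 hp2
  by_cases h2 : IsSquare (2 : ZMod p)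
  · -- `p` splits (or ramifies) in `F`: a degree-one `θ' ∣ μ`
    obtain ⟨u', v', g₀, g₁, t', c, d, hN', ht', hγ', hpos', hc, hd⟩ := exists_degOne_gen_dvd hpK h2 M₀ M₁ hpdvdN
    have hN'0 : u' ^ 2 - 6 * u' * v' + 7 * v' ^ 2 ≠ 0 := by rw [hN']; exact_mod_cast hpK.ne_zero
    have hposN' : 0 < u' ^ 2 - 6 * u' * v' + 7 * v' ^ 2 := by rw [hN']; exact_mod_cast hpK.pos
    -- `θ' ∤ π`
    have hcopπ : ¬ ∃ e₁ f₁ : ℤ, u = u' * e₁ - 7 * v' * f₁ ∧ v = u' * f₁ + v' * e₁ - 6 * v' * f₁ := by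
      rintro ⟨e₁, f₁, he, hf⟩
      apply hpπ
      refine ⟨e₁ ^ 2 - 6 * e₁ * f₁ + 7 * f₁ ^ 2, ?_⟩
      rw [he, hf, ← hN']; ring
    -- total positivity of `μ'' = (c, d)`
    subst hc hd
    have hpos'' := totPos_cancel hpos' hposN' hpos (by rw [hNμ]; positivity)
    by_cases hsq : IsSquare (-(t' : ZMod p))
    · -- SPLIT type: peel with the integral witness of `HWdeg`
      have hplt : p < n := lt_of_le_of_lt (Nat.le_of_dvd (Nat.pos_of_ne_zero hK0) ⟨K', hK'⟩) hKn
      obtain ⟨a₀, a₁, b₀, b₁, m₀, m₁, ew, hXw, hYw, hposw, hNw⟩ :=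
        HWdeg u' v' g₀ g₁ t' p hpK hp2 hplt hN' ht' hγ' hpos' hsq
      obtain ⟨A₁, B₁, C₁, D₁, hX₁, hY₁⟩ :=
        split_peel hN'0 (degOne_euclid hN' ht' hγ' hpK) u v A B C D c d a₀ a₁ b₀ b₁ m₀ m₁ hX hY hXw hYw
      have hposnew := totPos_mul hpos''.1 hpos''.2 hposw (by rw [hNw]; positivity)
      -- `N(μ''·μ_w) = 2^(e + ew)·K'`
      have hNnew : (c * m₀ - 7 * d * m₁) ^ 2 - 6 * (c * m₀ - 7 * d * m₁) * (c * m₁ + d * m₀ - 6 * d * m₁)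
          + 7 * (c * m₁ + d * m₀ - 6 * d * m₁) ^ 2 = 2 ^ (e + ew) * (K' : ℕ) := by
        rw [zs_norm_mul, hNw]
        have h1 : (p : ℤ) * (c ^ 2 - 6 * c * d + 7 * d ^ 2) = (p : ℤ) * (2 ^ e * K') := by
          have := hNμ
          rw [zs_norm_mul, hN', hK'] at this
          push_cast at this
          linear_combination this
        have h2' := mul_left_cancel₀ (by exact_mod_cast hpK.ne_zero : (p : ℤ) ≠ 0) h1
        rw [h2', pow_add]; ring
      refine ih K' hK'lt (lt_trans hK'lt hKn) (e + ew) A₁ B₁ C₁ D₁ _ _ hNnew hposnew.1 ?_ hX₁ hY₁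
      -- odd primes dividing `N(μ'')·2^ew` divide `N(μ)`
      intro q hq hq2 hqd
      rw [zs_norm_mul, hNw] at hqd
      have hqp : Prime (q : ℤ) := Nat.prime_iff_prime_int.1 hq
      rcases hqp.dvd_or_dvd hqd with h | h
      · refine hcop q hq hq2 ?_
        have h' := Dvd.dvd.mul_left h (u' ^ 2 - 6 * u' * v' + 7 * v' ^ 2)
        first
          | exact h'
          | (rw [← zs_norm_mul] at h'; exact h')
      · exfalso
        have h2q : (q : ℤ) ∣ 2 := hqp.dvd_of_dvd_pow h
        have : q ∣ 2 := by exact_mod_cast h2q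
        rcases (Nat.dvd_prime Nat.prime_two).1 this with h1 | h1
        · exact hq.one_lt.ne' h1
        · exact hq2 h1
    · -- INERT type: `θ'² ∣ μ`
      have hns : ∀ s : ZMod p, s ^ 2 ≠ -(t' : ZMod p) := forall_sq_ne_of_not_isSquare hsq
      obtain ⟨A₁, B₁, C₁, D₁, N₀, N₁, hN₀, hN₁, hX₁, hY₁⟩ :=
        inert_peel hN'0 (degOne_euclid hN' ht' hγ' hpK) (degOne_primeE hpK hN' ht' hγ' hns) u v hcopπ
          A B C D c d hX hY
      subst hN₀ hN₁
      have hpos3 := totPos_cancel hpos' hposN' hpos''.1 hpos''.2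
      -- `N(μ) = p²·N(ν) = 2^e·K`, so `p² ∣ K`
      have hNν : (p : ℤ) ^ 2 * (N₀ ^ 2 - 6 * N₀ * N₁ + 7 * N₁ ^ 2) = 2 ^ e * K := by
        rw [← hNμ, zs_norm_mul, zs_norm_mul, hN']; ring
      have hdK : p ^ 2 ∣ K := by
        have h1 : (p : ℤ) ^ 2 ∣ 2 ^ e * (K : ℤ) := ⟨_, hNν.symm⟩
        have h2' : p ^ 2 ∣ 2 ^ e * K := by exact_mod_cast h1
        exact (Nat.Coprime.pow 2 e hcop2).dvd_of_dvd_mul_left h2'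
      obtain ⟨K'', hK''⟩ := hdK
      have hK''lt : K'' < K := by
        have : 1 < p ^ 2 := Nat.one_lt_pow (by norm_num) hp1
        rcases Nat.eq_zero_or_pos K'' with h | h
        · rw [h, mul_zero] at hK''; exact absurd hK'' hK0
        · calc K'' = 1 * K'' := (one_mul _).symm
            _ < p ^ 2 * K'' := Nat.mul_lt_mul_of_pos_right this h
            _ = K := hK''.symm
      have hNν' : N₀ ^ 2 - 6 * N₀ * N₁ + 7 * N₁ ^ 2 = 2 ^ e * (K'' : ℕ) := by
        have h1 : (p : ℤ) ^ 2 * (N₀ ^ 2 - 6 * N₀ * N₁ + 7 * N₁ ^ 2) = (p : ℤ) ^ 2 * (2 ^ e * K'') := by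
          rw [hNν, hK'']; push_cast; ring
        exact mul_left_cancel₀ (pow_ne_zero 2 (by exact_mod_cast hpK.ne_zero)) h1
      refine ih K'' hK''lt (lt_trans hK''lt hKn) e A₁ B₁ C₁ D₁ N₀ N₁ hNν' hpos3.1 ?_ hX₁ hY₁
      intro q hq hq2 hqd
      refine hcop q hq hq2 ?_
      rw [zs_norm_mul, zs_norm_mul]
      exact Dvd.dvd.mul_left (Dvd.dvd.mul_left hqd _) _
  · -- `p` inert in `F`: `p ∣ μ`
    obtain ⟨⟨c, hc⟩, ⟨d, hd⟩⟩ := zs_inert_dvd hpK h2 hpdvdN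
    have hN'0 : (p : ℤ) ^ 2 - 6 * p * 0 + 7 * 0 ^ 2 ≠ 0 := by
      have : (p : ℤ) ≠ 0 := by exact_mod_cast hpK.ne_zero
      simpa using pow_ne_zero 2 this
    have hpos' : 0 < (p : ℤ) - 3 * 0 := by have := hpK.pos; simp; exact_mod_cast this
    have hposN' : 0 < (p : ℤ) ^ 2 - 6 * p * 0 + 7 * 0 ^ 2 := by
      have : (0 : ℤ) < p := by exact_mod_cast hpK.pos
      nlinarith
    have hcopπ : ¬ ∃ e₁ f₁ : ℤ, u = (p : ℤ) * e₁ - 7 * 0 * f₁ ∧ v = (p : ℤ) * f₁ + 0 * e₁ - 6 * 0 * f₁ := by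
      rintro ⟨e₁, f₁, he, hf⟩
      apply hpπ
      refine ⟨p * (e₁ ^ 2 - 6 * e₁ * f₁ + 7 * f₁ ^ 2), ?_⟩
      rw [he, hf]; ring
    -- rewrite `μ = (p, 0)·(c, d)`
    have hc' : M₀ = (p : ℤ) * c - 7 * 0 * d := by rw [hc]; ring
    have hd' : M₁ = (p : ℤ) * d + 0 * c - 6 * 0 * d := by rw [hd]; ring
    clear hc hd
    subst hc' hd'
    have hpos'' := totPos_cancel hpos' hposN' hpos (by rw [hNμ]; positivity)
    by_cases h7 : IsSquare (7 : ZMod p)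
    · -- SPLIT type (inert rational prime split in `E/F`): `HWinert`
      have hp2lt : p ^ 2 < n := by
        -- `p² ∣ N(μ) = 2^e K`, so `p² ∣ K ≤ K < n`
        have hNν : (p : ℤ) ^ 2 * (c ^ 2 - 6 * c * d + 7 * d ^ 2) = 2 ^ e * K := by
          rw [← hNμ, zs_norm_mul]; ring
        have h1 : (p : ℤ) ^ 2 ∣ 2 ^ e * (K : ℤ) := ⟨_, hNν.symm⟩
        have h2' : p ^ 2 ∣ 2 ^ e * K := by exact_mod_cast h1
        have h3 := (Nat.Coprime.pow 2 e hcop2).dvd_of_dvd_mul_left h2'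
        exact lt_of_le_of_lt (Nat.le_of_dvd (Nat.pos_of_ne_zero hK0) h3) hKn
      obtain ⟨a₀, a₁, b₀, b₁, m₀, m₁, ew, hXw, hYw, hposw, hNw⟩ := HWinert p hpK hp2 hp2lt h2 h7
      obtain ⟨A₁, B₁, C₁, D₁, hX₁, hY₁⟩ :=
        split_peel hN'0 (inertRat_euclid hpK h2) u v A B C D c d a₀ a₁ b₀ b₁ m₀ m₁ hX hY hXw hYw
      have hposnew := totPos_mul hpos''.1 hpos''.2 hposw (by rw [hNw]; positivity)
      -- `N(μ''·μ_w) = 2^(e+ew)·(K/p²)`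
      have hdK : p ^ 2 ∣ K := by
        have hNν : (p : ℤ) ^ 2 * (c ^ 2 - 6 * c * d + 7 * d ^ 2) = 2 ^ e * K := by
          rw [← hNμ, zs_norm_mul]; ring
        have h1 : (p : ℤ) ^ 2 ∣ 2 ^ e * (K : ℤ) := ⟨_, hNν.symm⟩
        have h2' : p ^ 2 ∣ 2 ^ e * K := by exact_mod_cast h1
        exact (Nat.Coprime.pow 2 e hcop2).dvd_of_dvd_mul_left h2'
      obtain ⟨K'', hK''⟩ := hdK
      have hK''lt : K'' < K := by
        have : 1 < p ^ 2 := Nat.one_lt_pow (by norm_num) hp1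
        rcases Nat.eq_zero_or_pos K'' with h | h
        · rw [h, mul_zero] at hK''; exact absurd hK'' hK0
        · calc K'' = 1 * K'' := (one_mul _).symm
            _ < p ^ 2 * K'' := Nat.mul_lt_mul_of_pos_right this h
            _ = K := hK''.symm
      have hNnew : (c * m₀ - 7 * d * m₁) ^ 2 - 6 * (c * m₀ - 7 * d * m₁) * (c * m₁ + d * m₀ - 6 * d * m₁)
          + 7 * (c * m₁ + d * m₀ - 6 * d * m₁) ^ 2 = 2 ^ (e + ew) * (K'' : ℕ) := by
        rw [zs_norm_mul, hNw]
        have h1 : (p : ℤ) ^ 2 * (c ^ 2 - 6 * c * d + 7 * d ^ 2) = (p : ℤ) ^ 2 * (2 ^ e * K'') := by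
          have := hNμ
          rw [zs_norm_mul, hK''] at this
          push_cast at this
          linear_combination this
        have h2' := mul_left_cancel₀ (pow_ne_zero 2 (by exact_mod_cast hpK.ne_zero : (p : ℤ) ≠ 0)) h1
        rw [h2', pow_add]; ring
      refine ih K'' hK''lt (lt_trans hK''lt hKn) (e + ew) A₁ B₁ C₁ D₁ _ _ hNnew hposnew.1 ?_ hX₁ hY₁
      intro q hq hq2 hqd
      rw [zs_norm_mul, hNw] at hqd
      have hqp : Prime (q : ℤ) := Nat.prime_iff_prime_int.1 hq
      rcases hqp.dvd_or_dvd hqd with h | h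
      · refine hcop q hq hq2 ?_
        have h' := Dvd.dvd.mul_left h ((p : ℤ) ^ 2 - 6 * p * 0 + 7 * 0 ^ 2)
        first
          | exact h'
          | (rw [← zs_norm_mul] at h'; exact h')
      · exfalso
        have h2q : (q : ℤ) ∣ 2 := hqp.dvd_of_dvd_pow h
        have : q ∣ 2 := by exact_mod_cast h2q
        rcases (Nat.dvd_prime Nat.prime_two).1 this with h1 | h1
        · exact hq.one_lt.ne' h1
        · exact hq2 h1
    · -- INERT type (inert in `F` and in `E/F`): `p² ∣ μ`
      obtain ⟨A₁, B₁, C₁, D₁, N₀, N₁, hN₀, hN₁, hX₁, hY₁⟩ :=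
        inert_peel hN'0 (inertRat_euclid hpK h2) (inertRat_primeE hpK h2 h7) u v hcopπ A B C D c d hX hY
      subst hN₀ hN₁
      have hpos3 := totPos_cancel hpos' hposN' hpos''.1 hpos''.2
      have hNν : (p : ℤ) ^ 4 * (N₀ ^ 2 - 6 * N₀ * N₁ + 7 * N₁ ^ 2) = 2 ^ e * K := by
        rw [← hNμ, zs_norm_mul, zs_norm_mul]; ring
      have hdK : p ^ 4 ∣ K := by
        have h1 : (p : ℤ) ^ 4 ∣ 2 ^ e * (K : ℤ) := ⟨_, hNν.symm⟩
        have h2' : p ^ 4 ∣ 2 ^ e * K := by exact_mod_cast h1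
        exact (Nat.Coprime.pow 4 e hcop2).dvd_of_dvd_mul_left h2'
      obtain ⟨K'', hK''⟩ := hdK
      have hK''lt : K'' < K := by
        have : 1 < p ^ 4 := Nat.one_lt_pow (by norm_num) hp1
        rcases Nat.eq_zero_or_pos K'' with h | h
        · rw [h, mul_zero] at hK''; exact absurd hK'' hK0
        · calc K'' = 1 * K'' := (one_mul _).symm
            _ < p ^ 4 * K'' := Nat.mul_lt_mul_of_pos_right this h
            _ = K := hK''.symm
      have hNν' : N₀ ^ 2 - 6 * N₀ * N₁ + 7 * N₁ ^ 2 = 2 ^ e * (K'' : ℕ) := by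
        have h1 : (p : ℤ) ^ 4 * (N₀ ^ 2 - 6 * N₀ * N₁ + 7 * N₁ ^ 2) = (p : ℤ) ^ 4 * (2 ^ e * K'') := by
          rw [hNν, hK'']; push_cast; ring
        exact mul_left_cancel₀ (pow_ne_zero 4 (by exact_mod_cast hpK.ne_zero)) h1
      refine ih K'' hK''lt (lt_trans hK''lt hKn) e A₁ B₁ C₁ D₁ N₀ N₁ hNν' hpos3.1 ?_ hX₁ hY₁
      intro q hq hq2 hqd
      refine hcop q hq hq2 ?_
      rw [zs_norm_mul, zs_norm_mul]
      exact Dvd.dvd.mul_left (Dvd.dvd.mul_left hqd _) _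

end Summit.HodgeConjecture.HodgeConjecture.Ring2.WeilCoverageCM

end
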